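import Mathlib
import Summits.MatrixMultiplication.MatrixMultiplication.Theses.ConeDesigns

/-!
# `ConeDesigns.Assembly` (stmt-MatrixMultiplication-9768) — proved

The assembly item of route `MatrixMultiplication/ConeDesigns` is the implication
`ConeDesignThesis → ConeCertificate → ConesBoundOmega → MatrixMultiplication`
(exactly the type of the route file's deciding theorem `closes`). It is pure logic over the
proved flattening bound `ω(ℂ) ≥ 2` (`Literature.Computability.AlgebraicComplexity.omega_two_le`):
rewrite the summit as `ω(ℂ) = 2` (`MatrixMultiplication_iff`); for `ω ≤ 2` use
`le_of_forall_pos_le_add` — given `θ > 0`, the thesis supplies the rank `n` and, for each `q₀`, a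
prime `q ≥ q₀` with a cone STPP design of `N ≥ q^(n−2−θ)` triangles of nonzero vectors in
`(ZMod q)^n`; `ConeCertificate` turns the design into `N·(q−1)^ω ≤ q^n`, and `ConesBoundOmega`
(with `w := ω(ℂ)`) returns `ω ≤ 2 + θ`. The proof is self-contained (it follows — but does not
invoke — `closes`).
-/

-- Summit = sub-problem name here (single-conjunct summit), so the conventional namespace
-- `Summit.MatrixMultiplication.MatrixMultiplication.Theorems` trips `dupNamespace` on every decl.
set_option linter.dupNamespace false

namespace Summit.MatrixMultiplication.MatrixMultiplication.Theorems

open Literature.Computability.AlgebraicComplexity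

/-- **Assembly of route `ConeDesigns` (stmt-MatrixMultiplication-9768), exact signature
`ConeDesignThesis → ConeCertificate → ConesBoundOmega → MatrixMultiplication`.**
`ω(ℂ) ≥ 2` is the flattening bound `omega_two_le ℂ`; `ω(ℂ) ≤ 2` follows from
`le_of_forall_pos_le_add`: for `θ > 0` and every `q₀` the thesis gives a prime `q ≥ q₀` and a cone
STPP design of `N ≥ q^(n−2−θ)` triangles, the certificate gives `N·(q−1)^ω ≤ q^n`, and the
analysis glue `ConesBoundOmega` (at `w = ω(ℂ)`) concludes `ω ≤ 2 + θ`. [folklore] -/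
theorem coneDesigns_assembly_proof :
    Summit.MatrixMultiplication.MatrixMultiplication.Theses.ConeDesigns.Assembly := by
  unfold Summit.MatrixMultiplication.MatrixMultiplication.Theses.ConeDesigns.Assembly
  intro hT hC hB
  rw [MatrixMultiplication_iff]
  refine le_antisymm ?_ (omega_two_le ℂ)
  obtain ⟨n, hn⟩ := hT
  refine le_of_forall_pos_le_add fun θ hθ => hB _ θ hθ fun q₀ => ?_
  obtain ⟨q, hq, hp, N, a, b, c, hnz, hS, hN⟩ := hn θ hθ q₀
  exact ⟨q, n, N, hq, hC n q N a b c hnz hS, hN⟩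

end Summit.MatrixMultiplication.MatrixMultiplication.Theorems
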